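import Literature.NumberTheory.EllipticCurves.MordellCurveTwistedIsogenyBox
import Summits.BirchSwinnertonDyer.BirchSwinnertonDyer.Theorems.BiquadraticEisensteinDescentHeegnerTwistCouplingInSupplySylvesterTwistPhiHatBox
import HarnessLib

set_option linter.dupNamespace false -- `Summit.BirchSwinnertonDyer.BirchSwinnertonDyer.Theorems.…` (summit = sub, D-0017)
set_option autoImplicit false

/-!
# Crux `HeegnerTwistCouplingInSupply` (stmt-BirchSwinnertonDyer-21381) — programme «TWISTED 3-ISOGENY DESCENT», file P7a:
# `Ш(E'/ℚ) ∩ ker φ̂_* = 0` for `E' : y² = x³ + 54p²` (the `3`-isogenous partner of the Sylvester twist `y² = x³ − 2p²`)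
# under the certificate (h2) `9 ∤ a`, `p = a² + 2b² ≡ 8 (mod 9)`

Route `BiquadraticEisensteinDescent` (cell `pub/bsd-wall`, width seat `bsd-wall-cm-bed-w4` g32; `--supports` 21381, helper). The `φ̂`-HALF
of the descent, assembled over `ℚ`: the kernel `{O, (0, ±3p√6)}` of `φ̂ : E' → E'' ≅ E` is the `ℤ/3` TWISTED by `χ₆`; its Kummer field is
`L = ℚ(√(−3·54p²)) = ℚ(√−2) = K`, over which the kernel is `μ₃` and the Mordell datum `E'_K = mordellCurve(−3c'²)`, `c' = 3pθ`
(`θ² = −2`) applies. The generic twisted-kernel theorem `Literature…TwistedKummer.eq_zero_of_mem_sha_of_galH1Map_eq_zero_mordell` (P3c)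
reduces `Ш(E'/ℚ) ∩ ker φ̂_* = 0` to the SHARP norm-cube box over `K`, which is file P6c₂
(`torsorClass_eq_zero_of_mem_sha_of_norm_cube`, certificate `9 ∤ a`).

* §1 `sq_ne_neg_three` (`√−3 ∉ ℚ(√−2)`), `algEquiv_apply_apply` (`c ∘ c = 1`), `pointFun_eq_of_sq_eq` (Vélu's map depends on `s²` only),
  `exists_muThreeKernel_of_eq` (the Mordell `μ₃`-datum transported along `(mordellCurve k)_K = mordellCurve (k : K)`);
* §2 ★★ `eq_zero_of_mem_sha_of_galH1Map_phiHat_eq_zero` — for ANY model `K ∋ θ` of `ℚ(√−2)`, `p ≡ 8 (mod 9)` prime, `p = a² + 2b²`,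
  `9 ∤ a`, ANY Vélu pair `hV` with parameters `(0, s)` on `E' = mordellCurve(54p²)` over `ℚ̄` and any equivariant `f = hV.pointFun`:
  every `c₀ ∈ Ш(E'/ℚ)` with `f_* c₀ = 0` is `0`.

HONEST FRAMING: one half (`φ̂`) of a `3`-isogeny descent for ONE CM family under the decidable certificate (h2); the `φ`-half (Kummer
field `ℚ(√6)`, certificate (h1)), `rank = 0 ∧ Ш[3] = 0`, `hDescU`, the crux (residual C⁺) and BSD are untouched. THEOREMS ONLY (no `def`,
no named fact, no sorry). Supports stmt-BirchSwinnertonDyer-21381.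
[cite: CohenPazuki2009, Proposition 2.2 and §4] [cite: SilvermanAEC2009, Thm. X.4.2 (a), Remark III.4.13.2]
-/

noncomputable section

open scoped Classical

namespace Summit.BirchSwinnertonDyer.BirchSwinnertonDyer.Theorems.SylvesterTwistDescent

open Literature.NumberTheory.EllipticCurves Literature.NumberTheory.EllipticCurves.MordellDescent
open Literature.NumberTheory.EllipticCurves.TwistedKummer Literature.NumberTheory.QuadraticFields
open Literature.NumberTheory.GaloisRepresentations NumberField
open WeierstrassCurve

/-! ## §1 Small inputs -/

section Inputs

variable {K : Type} [Field K] [NumberField K] {θ : K} (hK : SqrtNegTwo.FieldData θ)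

include hK in
/-- **`√−3 ∉ ℚ(√−2)`**: no `q ∈ K` has `q² = −3` (`q` would be an algebraic integer `x + yθ`, `x, y ∈ ℤ`, and
`(x² − 2y² + 3) + 2xyθ = 0` forces `xy = 0`, then `2y² = 3` or `x² = −3`). [cite: Marcus2018, Ch. 2 Thm. 1 and Cor. 2] -/
theorem sq_ne_neg_three (q : K) : q ^ 2 ≠ -3 := by
  intro hq
  have hθ := hK.sq_eq
  have hint : IsIntegral ℤ q := by
    refine ⟨Polynomial.X ^ 2 + Polynomial.C 3, Polynomial.monic_X_pow_add_C _ two_ne_zero, ?_⟩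
    simp [hq]
  obtain ⟨w, hw⟩ := hK.ringEquiv.surjective ⟨q, hint⟩
  have hqK : (w.re : K) + (w.im : K) * θ = q := by
    have := congrArg (fun z : 𝓞 K => (z : K)) hw
    simpa [hK.coe_ringEquiv] using this
  have key : ((w.re : K) ^ 2 - 2 * (w.im : K) ^ 2 + 3) + (2 * (w.re : K) * (w.im : K)) * θ = 0 := by
    rw [← hqK] at hq
    linear_combination hq - ((w.im : K)) ^ 2 * hθ
  by_cases hxy : (2 * (w.re : K) * (w.im : K)) = 0
  · rw [hxy, zero_mul, add_zero] at key
    have keyZ : (w.re : ℤ) ^ 2 - 2 * w.im ^ 2 + 3 = 0 := by exact_mod_cast key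
    have hxy' : w.re = 0 ∨ w.im = 0 := by
      rcases mul_eq_zero.mp hxy with h | h
      · left; exact_mod_cast (mul_eq_zero.mp h).resolve_left two_ne_zero
      · right; exact_mod_cast h
    rcases hxy' with h | h <;> rw [h] at keyZ
    · have : (2 : ℤ) ∣ 3 := ⟨w.im ^ 2, by linarith⟩
      omega
    · nlinarith [sq_nonneg w.re]
  · apply hK.not_mem_range
    refine ⟨-(((w.re : ℚ) ^ 2 - 2 * (w.im : ℚ) ^ 2 + 3) / (2 * w.re * w.im)), ?_⟩
    rw [map_neg, map_div₀]
    simp only [map_add, map_sub, map_mul, map_pow, map_ofNat, map_intCast]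
    rw [← neg_div, div_eq_iff hxy]
    linear_combination -key

include hK in
/-- `c (c x) = x` for an automorphism of the quadratic field `K`. [cite: Marcus2018, Ch. 2 (the conjugation `√m ↦ −√m`)] -/
theorem algEquiv_apply_apply (c : K ≃ₐ[ℚ] K) (x : K) : c (c x) = x := by
  have hcard : Fintype.card (K ≃ₐ[ℚ] K) ≤ 2 := hK.finrank_eq ▸ AlgEquiv.card_le
  have hdvd : orderOf c ∣ Fintype.card (K ≃ₐ[ℚ] K) := orderOf_dvd_card
  have hle : orderOf c ≤ 2 := (Nat.le_of_dvd Fintype.card_pos hdvd).trans hcard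
  have hpos : 0 < orderOf c := orderOf_pos c
  have h2 : c ^ 2 = 1 := by
    interval_cases h : orderOf c
    · rw [orderOf_eq_one_iff.mp h, one_pow]
    · rw [← h, pow_orderOf_eq_one]
  have := congrArg (fun σ : K ≃ₐ[ℚ] K => σ x) h2
  simpa [sq, AlgEquiv.mul_apply] using this

end Inputs

/-- **Vélu's map depends on `s²` only**: two Vélu pairs with parameters `(0, s₁)`, `(0, s₂)`, `s₁² = s₂²`, on the same curves have the
same map on points (`X = (x³ + 4s²)/x²`, `Y = y(x³ − 8s²)/x³`). [cite: SilvermanAEC2009, Remark III.4.13.2] -/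
theorem pointFun_eq_of_sq_eq {F : Type*} [Field F] {W W' : WeierstrassCurve F} {s₁ s₂ : F} (hV₁ : IsVeluThreePair (0 : F) s₁ W W')
    (hV₂ : IsVeluThreePair (0 : F) s₂ W W') (h : s₁ ^ 2 = s₂ ^ 2) (P : W.toAffine.Point) : hV₁.pointFun P = hV₂.pointFun P := by
  rcases P with _ | ⟨x, y, hxy⟩
  · rfl
  · by_cases hx : x = 0
    · rw [hV₁.pointFun_some_of_eq_zero _ hx, hV₂.pointFun_some_of_eq_zero _ hx]
    · rw [hV₁.pointFun_some _ hx, hV₂.pointFun_some _ hx]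
      refine point_some_ext ?_ ?_
      · simp only [IsVeluThreePair.X, mul_zero, zero_mul, add_zero, h]
      · simp only [IsVeluThreePair.Y, mul_zero, zero_mul, sub_zero, h]

/-- **The Mordell `μ₃`-datum transported along an equality of curves** (`W = mordellCurve D`, e.g. `(mordellCurve k)_K = mordellCurve (k : K)`):
a `MuThreeKernel W` with kernel point `(0, c√−3)` whose Ш-box is that of `MordellDescent.torsorClass`. [cite: SilvermanAEC2009, Thm. X.4.2 (a)] -/
theorem exists_muThreeKernel_of_eq {K : Type} [Field K] [NumberField K] {W : WeierstrassCurve K} {D c₁ : K} (hc₁ : c₁ ≠ 0)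
    (hD : D = -3 * c₁ ^ 2) (hW : W = mordellCurve D) :
    ∃ (𝒯 : MuThreeKernel W) (h₀ : (W.baseChange (AlgebraicClosure K)).toAffine.Nonsingular 0 (sCoord c₁)),
      𝒯.T = Affine.Point.some 0 (sCoord c₁) h₀ ∧
        ∀ {u : K} (hu : u ≠ 0), (torsorClass hc₁ hD hu ∈ (mordellCurve D).sha → torsorClass hc₁ hD hu = 0) →
          𝒯.torsorClass hu ∈ W.sha → 𝒯.torsorClass hu = 0 := by
  subst hW
  refine ⟨MuThreeKernel.ofMordell hc₁ hD, _, torsT_eq hc₁ hD, fun hu hbox hs => ?_⟩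
  rw [MuThreeKernel.torsorClass_ofMordell] at hs ⊢
  exact hbox hs

/-! ## §2 `Ш(E'/ℚ) ∩ ker φ̂_* = 0` under (h2) -/

section PhiHat

variable {K : Type} [Field K] [NumberField K] {θ : K} (hK : SqrtNegTwo.FieldData θ) (c : K ≃ₐ[ℚ] K) (hc : c ≠ 1)
  {p : ℕ} (hp : p.Prime) (hp9 : p % 9 = 8) {a b : ℤ} (hab : a ^ 2 + 2 * b ^ 2 = p)

include hK hc hp hp9 hab in
/-- ★★ **`Ш(E'/ℚ) ∩ ker φ̂_* = 0` for `E' : y² = x³ + 54p²` under (h2).** Let `K ∋ θ`, `θ² = −2` be a model of `ℚ(√−2)` with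
non-trivial automorphism `c`, `p ≡ 8 (mod 9)` a prime, `p = a² + 2b²` with `9 ∤ a`. For every Vélu pair `hV` with parameters `(0, s)` on
`E' = mordellCurve(54p²)` / `E'' = mordellCurve(−27·54p²)` over `ℚ̄` (they exist for each `s` with `s² = 54p²`,
`TwistedKummer.isVeluThreePair_of_sq_eq`) and every `Γ_ℚ`-equivariant `f` agreeing with `hV.pointFun` (`TwistedKummer.exists_hom_of_sq_eq`):
every `c₀ ∈ Ш(E'/ℚ)` with `f_* c₀ = 0` vanishes. Proof: P3c's `eq_zero_of_mem_sha_of_galH1Map_eq_zero_mordell` with Kummer field `L = K`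
(`−3·54p² = −2·(9p)²`), the Mordell datum `c' = 3pθ` on `E'_K` and the sharp box P6c₂. [cite: CohenPazuki2009, Proposition 2.2 and §4]
[cite: SilvermanAEC2009, Thm. X.4.2 (a)] -/
theorem eq_zero_of_mem_sha_of_galH1Map_phiHat_eq_zero (h9 : ¬ (9 : ℤ) ∣ a) {s : AlgebraicClosure ℚ}
    (hV : IsVeluThreePair (0 : AlgebraicClosure ℚ) s ((mordellCurve (54 * (p : ℚ) ^ 2)).baseChange (AlgebraicClosure ℚ))
      ((mordellCurve (-27 * (54 * (p : ℚ) ^ 2))).baseChange (AlgebraicClosure ℚ)))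
    (f : geomPoints (mordellCurve (54 * (p : ℚ) ^ 2)) →+ geomPoints (mordellCurve (-27 * (54 * (p : ℚ) ^ 2))))
    (hf : ∀ (σ : Field.absoluteGaloisGroup ℚ) (P : geomPoints (mordellCurve (54 * (p : ℚ) ^ 2))), f (σ • P) = σ • f P)
    (hfV : ∀ P, f P = hV.pointFun P)
    {c₀ : (mordellCurve (54 * (p : ℚ) ^ 2)).galH1} (hc₀ : c₀ ∈ (mordellCurve (54 * (p : ℚ) ^ 2)).sha) (h0 : galH1Map f hf c₀ = 0) :
    c₀ = 0 := by
  have hK2 := hK.finrank_eq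
  have hθ := hK.sq_eq
  have hcθ : c θ = -θ := hK.algEquiv_theta hc
  haveI : Algebra.IsQuadraticExtension ℚ K := { finrank_eq_two' := hK2 }
  haveI : IsGalois ℚ K := inferInstance
  -- the data over `ℚ`
  have hp0 : (p : ℚ) ≠ 0 := Nat.cast_ne_zero.mpr hp.ne_zero
  have hk0 : (54 * (p : ℚ) ^ 2) ≠ 0 := mul_ne_zero (by norm_num) (pow_ne_zero 2 hp0)
  -- the Kummer field `L = K`: involution, lift negating `√−3`, degree
  have hL : ∀ q : K, q ^ 2 ≠ -3 := sq_ne_neg_three hK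
  have hc2 : ∀ x : K, (c : K ≃+* K) ((c : K ≃+* K) x) = x := fun x => algEquiv_apply_apply hK c x
  obtain ⟨cbar, hcbar, hcbθ⟩ := exists_lift_neg_theta' hL (c : K ≃+* K)
  have hdeg : Nat.Coprime 3 (Module.finrank ℚ K) := by rw [hK2]; decide
  -- the Mordell datum on `E'_K`: `54p² = −3·(3pθ)²`
  have hθ0 : θ ≠ 0 := fun h => by rw [h] at hθ; norm_num at hθ
  have hc' : (3 * p * θ : K) ≠ 0 := mul_ne_zero (mul_ne_zero three_ne_zero (Nat.cast_ne_zero.mpr hp.ne_zero)) hθ0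
  have hD : algebraMap ℚ K (54 * (p : ℚ) ^ 2) = -3 * (3 * p * θ) ^ 2 := by
    rw [map_mul, map_pow, map_natCast, map_ofNat]; linear_combination (27 * (p : K) ^ 2) * hθ
  obtain ⟨𝒯, h₀, hT𝒯, hbox𝒯⟩ := exists_muThreeKernel_of_eq hc' hD (mordellCurve_baseChange (54 * (p : ℚ) ^ 2) K)
  -- the kernel point is `c̄`-fixed: `c̄(3pθ·√−3) = (−3pθ)(−√−3)`
  have hy : cbar (sCoord (3 * p * θ : K)) = sCoord (3 * p * θ : K) := by
    have hcc : (c : K ≃+* K) (3 * p * θ) = -(3 * p * θ) := by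
      change c (3 * p * θ) = -(3 * p * θ)
      rw [map_mul, map_mul, map_natCast, map_ofNat, hcθ]; ring
    rw [sCoord, map_mul, hcbar, hcbθ, hcc, map_neg]; ring
  -- the transported point `T = (0, s₁)`, `s₁² = 54p² = s²`
  obtain ⟨T, hT⟩ := exists_geomPoint_transport 𝒯
  obtain ⟨s₁, hs₁0, hTs₁, -⟩ := exists_transport_eq_some_zero hT hT𝒯
  have hs₁ : s₁ ^ 2 = algebraMap ℚ (AlgebraicClosure ℚ) (54 * (p : ℚ) ^ 2) := sq_eq_of_nonsingular_zero hs₁0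
  have hs : s ^ 2 = algebraMap ℚ (AlgebraicClosure ℚ) (54 * (p : ℚ) ^ 2) := sq_eq_of_nonsingular_zero hV.nonsingular_T
  have hV₁ := isVeluThreePair_of_sq_eq hk0 hs₁
  have hfV₁ : ∀ P, f P = hV₁.pointFun P := fun P => (hfV P).trans (pointFun_eq_of_sq_eq hV hV₁ (by rw [hs, hs₁]) P)
  -- the sharp box over `K` (P6c₂)
  have hbox : ∀ {u : K} (hu : u ≠ 0), (∃ r : K, (c : K ≃+* K) r = r ∧ r ≠ 0 ∧ u * (c : K ≃+* K) u = r ^ 3) →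
      𝒯.torsorClass hu ∈ ((mordellCurve (54 * (p : ℚ) ^ 2)).baseChange K).sha → 𝒯.torsorClass hu = 0 := by
    intro u hu hn
    have hn' : ∃ r : K, c r = r ∧ r ≠ 0 ∧ u * c u = r ^ 3 := hn
    exact hbox𝒯 hu (fun hs' => torsorClass_eq_zero_of_mem_sha_of_norm_cube hK c hc hp hp9 hab h9 hc' hD hu hn' hs')
  exact eq_zero_of_mem_sha_of_galH1Map_eq_zero_mordell (c : K ≃+* K) hc2 cbar hcbar hcbθ hL hdeg 𝒯 hT𝒯 hy hT hTs₁ hV₁ f hf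
    hfV₁ hbox hc₀ h0

end PhiHat

end Summit.BirchSwinnertonDyer.BirchSwinnertonDyer.Theorems.SylvesterTwistDescent

end
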